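import Mathlib.Analysis.SpecialFunctions.ImproperIntegrals
import Mathlib.Analysis.SpecialFunctions.Integrals.Basic
import Literature.Analysis.FunctionSpaces.TorusThetaBound
import Literature.Analysis.FunctionSpaces.TorusInverseLaplacianSup
import HarnessLib

/-!
# The lattice sum of Agmon's inequality on `T³`: `∑_{k ≠ 0} ρ/(μₖ(μₖ + ρ)) ≤ C ρ^{1/2}`

Analysis/FunctionSpaces support file (everything proved; no definitions, no named facts), sequel of
`TorusThetaBound.lean`. With `μₖ = 4π²|k|²` the eigenvalues of `−Δ` on the unit torus, the
Fourier-side proof of **Agmon's inequality** `‖u‖_∞ ≤ c ‖∇u‖₂^{1/2} ‖Δu‖₂^{1/2}` on `T³`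
(Foias–Manley–Rosa–Temam 2001, Ch. II App. A (A.29); Constantin–Foias 1988, Ch. 4) is the
Cauchy–Schwarz inequality `(∑_{k≠0} |ûₖ|)² ≤ (∑ₖ (μₖ + μₖ²/ρ)|ûₖ|²) · (∑_{k≠0} (μₖ + μₖ²/ρ)⁻¹)`
followed by the **lattice-sum bound** proved here,

`∑_{k ∈ ℤ³∖{0}} ρ / (μₖ (μₖ + ρ)) ≤ C ρ^{1/2}`  for every `ρ > 0`

(`Torus.tsum_agmonWeight_le`), and the choice `ρ = ‖Δu‖₂²/‖∇u‖₂²`. The proof integrates the heat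
trace: `ρ/(μ(μ+ρ)) = 1/μ − 1/(μ+ρ) = ∫₀^∞ e^{-μs}(1 − e^{-ρs}) ds`
(`integral_exp_neg_mul_one_sub_exp`), so the lattice sum is `∫₀^∞ (1 − e^{-ρs}) (Θ(s) − 1) ds`
with `Θ(s) = ∑ₖ e^{-4π²|k|²s}` (Tonelli), and `Θ(s) − 1 ≤ C₀ s^{-3/2}`
(`Torus.tsum_heatCoeff_sub_one_le_rpow`) with `1 − e^{-ρs} ≤ min(ρs, 1)` gives
`≤ C₀ (∫₀^{1/ρ} ρ s^{-1/2} ds + ∫_{1/ρ}^∞ s^{-3/2} ds) = 4 C₀ ρ^{1/2}`.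

## Mathlib / tree search

Mathlib: `integral_exp_mul_Ioi`, `integrableOn_exp_mul_Ioi`, `integral_rpow`,
`integral_Ioi_rpow_of_lt`, `lintegral_tsum`, `ENNReal.tsum_eq_add_tsum_ite`. Tree:
`TorusThetaBound` (heat trace), `TorusInverseLaplacianSup` (`summable_one_add_freqNormSq_rpow_neg`);
no lattice resolvent sums (searched `freqNormSq` with `rpow (1/2)`, `Agmon` on the torus side).

## References

* C. Foias, O. Manley, R. Rosa, R. Temam, *Navier–Stokes Equations and Turbulence*, CUP 2001,
  Ch. II App. A (A.29), PDF p. 113. [FoiasManleyRosaTemam2001]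
* P. Constantin, C. Foias, *Navier–Stokes Equations*, Univ. Chicago Press 1988, Ch. 4.
  [ConstantinFoias1988]
-/

noncomputable section

open MeasureTheory Set Filter Topology Real
open scoped ENNReal NNReal

namespace Literature.Analysis.FunctionSpaces

namespace Torus

variable {d : Type*} [Fintype d]

/-! ### The time integral behind the resolvent weight -/

omit [Fintype d] in
/-- `∫₀^∞ e^{-μs}(1 − e^{-ρs}) ds = 1/μ − 1/(μ + ρ)` for `μ, ρ > 0`. [folklore] -/
theorem integral_exp_neg_mul_one_sub_exp {μ ρ : ℝ} (hμ : 0 < μ) (hρ : 0 < ρ) :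
    ∫ s in Ioi (0 : ℝ), Real.exp (-μ * s) * (1 - Real.exp (-ρ * s)) = 1 / μ - 1 / (μ + ρ) := by
  have hfun : (fun s : ℝ => Real.exp (-μ * s) * (1 - Real.exp (-ρ * s))) =
      fun s => Real.exp (-μ * s) - Real.exp (-(μ + ρ) * s) := by
    funext s
    rw [mul_sub, mul_one, ← Real.exp_add]
    congr 2
    ring
  rw [hfun, integral_sub (integrableOn_exp_mul_Ioi (by linarith) 0)
    (integrableOn_exp_mul_Ioi (by linarith) 0), integral_exp_mul_Ioi (by linarith : -μ < 0) 0,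
    integral_exp_mul_Ioi (by linarith : -(μ + ρ) < 0) 0]
  simp only [mul_zero, Real.exp_zero]
  have hμρ : (μ + ρ) ≠ 0 := by linarith
  field_simp

omit [Fintype d] in
/-- The integrand `e^{-μs}(1 − e^{-ρs})` is nonnegative for `ρ, s ≥ 0`. [folklore] -/
theorem exp_neg_mul_one_sub_exp_nonneg {μ ρ s : ℝ} (hρ : 0 ≤ ρ) (hs : 0 ≤ s) :
    0 ≤ Real.exp (-μ * s) * (1 - Real.exp (-ρ * s)) := by
  refine mul_nonneg (Real.exp_pos _).le ?_
  rw [sub_nonneg, Real.exp_le_one_iff]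
  nlinarith

/-! ### The weights and their summability -/

/-- Off the origin the Agmon weight is dominated by a summable majorant:
`ρ/(μₖ(μₖ+ρ)) ≤ (ρ/(4π⁴)) (1+|k|²)^{-2}` (`μₖ = 4π²|k|² ≥ 4π²`, `(1+|k|²)² ≤ 4|k|⁴`).
[folklore] -/
theorem agmonWeight_le {ρ : ℝ} (hρ : 0 < ρ) {k : d → ℤ} (hk : k ≠ 0) :
    ρ / (4 * π ^ 2 * freqNormSq k * (4 * π ^ 2 * freqNormSq k + ρ)) ≤
      ρ / (4 * π ^ 4) * (1 + freqNormSq k) ^ (-(2 : ℝ)) := by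
  have h1 : 1 ≤ freqNormSq k := one_le_freqNormSq_of_ne_zero hk
  have hμ : 0 < 4 * π ^ 2 * freqNormSq k := by positivity
  have hrpow : (1 + freqNormSq k) ^ (-(2 : ℝ)) = ((1 + freqNormSq k) ^ 2)⁻¹ := by
    rw [Real.rpow_neg (by linarith), show (2 : ℝ) = ((2 : ℕ) : ℝ) by norm_num, Real.rpow_natCast]
  rw [hrpow, ← div_eq_mul_inv, div_div]
  refine div_le_div_of_nonneg_left hρ.le (by positivity) ?_
  -- `4π⁴ (1+|k|²)² ≤ 4π²|k|² (4π²|k|² + ρ)`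
  have h2 : (1 + freqNormSq k) ^ 2 ≤ 4 * freqNormSq k ^ 2 := by nlinarith
  have hπ4 : 0 < π ^ 4 := by positivity
  have h3 : 4 * π ^ 4 * (1 + freqNormSq k) ^ 2 ≤ 4 * π ^ 4 * (4 * freqNormSq k ^ 2) :=
    mul_le_mul_of_nonneg_left h2 (by positivity)
  have h4 : 0 ≤ 4 * π ^ 2 * freqNormSq k * ρ := by positivity
  nlinarith

/-- The Agmon weights `k ↦ ρ/(μₖ(μₖ+ρ))` (zero at the origin) are summable over `ℤ^d` for
`card d ≤ 3` (majorant `(1+|k|²)^{-2}`, summable since `2 > d/2`). [folklore] -/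
theorem summable_agmonWeight [Nonempty d] (hd : Fintype.card d ≤ 3) {ρ : ℝ} (hρ : 0 < ρ) :
    Summable fun k : d → ℤ =>
      if k = 0 then (0 : ℝ) else ρ / (4 * π ^ 2 * freqNormSq k * (4 * π ^ 2 * freqNormSq k + ρ)) := by
  classical
  have hs : (Fintype.card d : ℝ) < 2 * 2 := by
    have : (Fintype.card d : ℝ) ≤ 3 := by exact_mod_cast hd
    linarith
  have hmaj := (summable_one_add_freqNormSq_rpow_neg (d := d) hs).mul_left (ρ / (4 * π ^ 4))
  refine Summable.of_nonneg_of_le (fun k => ?_) (fun k => ?_) hmaj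
  · have hf := freqNormSq_nonneg k
    split_ifs
    · exact le_rfl
    · positivity
  · have hf := freqNormSq_nonneg k
    have hf1 : 0 < 1 + freqNormSq k := by linarith
    split_ifs with hk
    · exact mul_nonneg (by positivity) (Real.rpow_nonneg hf1.le _)
    · exact agmonWeight_le hρ hk

/-! ### The bound -/

omit [Fintype d] in
/-- `∫₀^{b} s^{-1/2} ds = 2 b^{1/2}` as a Lebesgue integral of `ofReal`, `b > 0`. [folklore] -/
theorem lintegral_Ioc_rpow_neg_half {b : ℝ} (hb : 0 < b) :
    ∫⁻ s in Ioc (0 : ℝ) b, ENNReal.ofReal (s ^ (-(1 / 2 : ℝ))) = ENNReal.ofReal (2 * b ^ (1 / 2 : ℝ)) := by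
  have hr : (-1 : ℝ) < -(1 / 2 : ℝ) := by norm_num
  have hint : IntegrableOn (fun s : ℝ => s ^ (-(1 / 2 : ℝ))) (Ioc 0 b) volume :=
    (intervalIntegrable_iff_integrableOn_Ioc_of_le hb.le).1
      (intervalIntegral.intervalIntegrable_rpow' hr)
  have hnn : 0 ≤ᵐ[volume.restrict (Ioc (0 : ℝ) b)] fun s : ℝ => s ^ (-(1 / 2 : ℝ)) := by
    filter_upwards [ae_restrict_mem measurableSet_Ioc] with s hs
    exact Real.rpow_nonneg hs.1.le _
  rw [← ofReal_integral_eq_lintegral_ofReal hint hnn, ← intervalIntegral.integral_of_le hb.le,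
    integral_rpow (Or.inl hr)]
  congr 1
  rw [show (-(1 / 2 : ℝ)) + 1 = 1 / 2 by norm_num, Real.zero_rpow (by norm_num), sub_zero]
  ring

omit [Fintype d] in
/-- `∫_{b}^∞ s^{-3/2} ds = 2 b^{-1/2}` as a Lebesgue integral of `ofReal`, `b > 0`. [folklore] -/
theorem lintegral_Ioi_rpow_neg_three_halves {b : ℝ} (hb : 0 < b) :
    ∫⁻ s in Ioi b, ENNReal.ofReal (s ^ (-(3 / 2 : ℝ))) = ENNReal.ofReal (2 * b ^ (-(1 / 2 : ℝ))) := by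
  have hr : (-(3 / 2 : ℝ)) < -1 := by norm_num
  have hint : IntegrableOn (fun s : ℝ => s ^ (-(3 / 2 : ℝ))) (Ioi b) volume :=
    integrableOn_Ioi_rpow_of_lt hr hb
  have hnn : 0 ≤ᵐ[volume.restrict (Ioi b)] fun s : ℝ => s ^ (-(3 / 2 : ℝ)) := by
    filter_upwards [ae_restrict_mem measurableSet_Ioi] with s hs
    exact Real.rpow_nonneg (hb.le.trans (le_of_lt hs)) _
  rw [← ofReal_integral_eq_lintegral_ofReal hint hnn, integral_Ioi_rpow_of_lt hr hb]
  congr 1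
  rw [show (-(3 / 2 : ℝ)) + 1 = -(1 / 2 : ℝ) by norm_num]
  norm_num
  ring

/-- **The lattice sum of Agmon's inequality on a three-dimensional torus.** On `ℤ^d` with
`card d = 3` there is `C ≥ 0` such that for every `ρ > 0`,
`∑_{k ≠ 0} ρ / (μₖ(μₖ + ρ)) ≤ C ρ^{1/2}`, `μₖ = 4π²|k|²`. Proof:
`ρ/(μ(μ+ρ)) = ∫₀^∞ e^{-μs}(1−e^{-ρs}) ds`, Tonelli, the heat-trace bound
`∑_{k≠0} e^{-μₖs} ≤ C₀ s^{-3/2}` (`Torus.tsum_heatCoeff_sub_one_le_rpow`) and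
`∫₀^∞ min(ρs, 1) s^{-3/2} ds = 4ρ^{1/2}`. [cite: ConstantinFoias1988, Ch. 4] -/
theorem tsum_agmonWeight_le (hd : Fintype.card d = 3) :
    ∃ C : ℝ, 0 ≤ C ∧ ∀ ρ : ℝ, 0 < ρ →
      ∑' k : d → ℤ, (if k = 0 then (0 : ℝ) else
        ρ / (4 * π ^ 2 * freqNormSq k * (4 * π ^ 2 * freqNormSq k + ρ))) ≤ C * ρ ^ (1 / 2 : ℝ) := by
  classical
  haveI : Nonempty d := by
    rw [← Fintype.card_pos_iff, hd]; norm_num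
  obtain ⟨C₀, hC₀, hΘ⟩ := tsum_heatCoeff_sub_one_le_rpow (d := d)
  rw [hd] at hΘ
  refine ⟨4 * C₀, by positivity, fun ρ hρ => ?_⟩
  set a : (d → ℤ) → ℝ := fun k => if k = 0 then (0 : ℝ) else
    ρ / (4 * π ^ 2 * freqNormSq k * (4 * π ^ 2 * freqNormSq k + ρ)) with ha_def
  have ha0 : ∀ k, 0 ≤ a k := fun k => by
    simp only [ha_def]
    split_ifs
    · exact le_rfl
    · have := freqNormSq_nonneg k
      positivity
  have has : Summable a := summable_agmonWeight hd.le hρ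
  -- ### the weights as time integrals, in `ℝ≥0∞`
  set G : (d → ℤ) → ℝ → ℝ≥0∞ := fun k s => if k = 0 then 0 else
    ENNReal.ofReal (Real.exp (-(4 * π ^ 2 * freqNormSq k) * s) * (1 - Real.exp (-ρ * s))) with hG_def
  have hGk : ∀ k, ENNReal.ofReal (a k) = ∫⁻ s in Ioi (0 : ℝ), G k s := by
    intro k
    by_cases hk : k = 0
    · simp [ha_def, hG_def, hk]
    · have hμ : 0 < 4 * π ^ 2 * freqNormSq k := by
        have := one_le_freqNormSq_of_ne_zero hk; positivity
      simp only [ha_def, hG_def, if_neg hk]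
      have hint : IntegrableOn (fun s : ℝ => Real.exp (-(4 * π ^ 2 * freqNormSq k) * s) *
          (1 - Real.exp (-ρ * s))) (Ioi 0) volume := by
        have h1 := integrableOn_exp_mul_Ioi (by linarith : -(4 * π ^ 2 * freqNormSq k) < 0) 0
        have h2 := integrableOn_exp_mul_Ioi (by linarith : -(4 * π ^ 2 * freqNormSq k + ρ) < 0) 0
        refine (h1.sub h2).congr_fun (fun s _ => ?_) measurableSet_Ioi
        rw [Pi.sub_apply, mul_sub, mul_one, ← Real.exp_add]
        congr 2
        ring
      have hnn : 0 ≤ᵐ[volume.restrict (Ioi (0 : ℝ))] fun s : ℝ =>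
          Real.exp (-(4 * π ^ 2 * freqNormSq k) * s) * (1 - Real.exp (-ρ * s)) := by
        filter_upwards [ae_restrict_mem measurableSet_Ioi] with s hs
        exact exp_neg_mul_one_sub_exp_nonneg hρ.le (le_of_lt hs)
      rw [← ofReal_integral_eq_lintegral_ofReal hint hnn, integral_exp_neg_mul_one_sub_exp hμ hρ]
      congr 1
      have hf0 : freqNormSq k ≠ 0 := by
        have := one_le_freqNormSq_of_ne_zero hk; linarith
      have hμρ0 : 4 * π ^ 2 * freqNormSq k + ρ ≠ 0 := by linarith
      have hπ0 : (π : ℝ) ≠ 0 := Real.pi_ne_zero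
      field_simp
      ring
  -- ### Tonelli
  have hGmeas : ∀ k, Measurable (G k) := by
    intro k
    by_cases hk : k = 0
    · simp only [hG_def, if_pos hk]
      exact measurable_const
    · simp only [hG_def, if_neg hk]
      exact ((Real.continuous_exp.comp (continuous_const.mul continuous_id)).mul
        (continuous_const.sub (Real.continuous_exp.comp
          (continuous_const.mul continuous_id)))).measurable.ennreal_ofReal
  have hT : ∑' k, ∫⁻ s in Ioi (0 : ℝ), G k s = ∫⁻ s in Ioi (0 : ℝ), ∑' k, G k s :=
    (lintegral_tsum fun k => (hGmeas k).aemeasurable).symm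
  -- ### the integrand: `∑ₖ G k s = (1 − e^{-ρs}) (Θ(s) − 1)` for `s > 0`
  have hsum_s : ∀ s : ℝ, 0 < s → ∑' k, G k s =
      ENNReal.ofReal ((1 - Real.exp (-ρ * s)) * ((∑' k : d → ℤ, heatCoeff s k) - 1)) := by
    intro s hs
    have h1s : 0 ≤ 1 - Real.exp (-ρ * s) := by
      rw [sub_nonneg, Real.exp_le_one_iff]; nlinarith
    have hsumm := summable_heatCoeff (d := d) hs
    -- the heat trace without the zero mode, as an `ℝ≥0∞` sum
    have hX : ENNReal.ofReal (∑' k : d → ℤ, heatCoeff s k) =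
        1 + ∑' k : d → ℤ, (if k = 0 then (0 : ℝ≥0∞) else ENNReal.ofReal (heatCoeff s k)) := by
      rw [ENNReal.ofReal_tsum_of_nonneg (fun k => (heatCoeff_pos s k).le) hsumm,
        ENNReal.tsum_eq_add_tsum_ite (f := fun k : d → ℤ => ENNReal.ofReal (heatCoeff s k)) 0,
        heatCoeff_zero_right, ENNReal.ofReal_one]
      congr 1
      exact tsum_congr fun k => by split_ifs <;> rfl
    have hΘ' : ∑' k : d → ℤ, (if k = 0 then (0 : ℝ≥0∞) else ENNReal.ofReal (heatCoeff s k)) =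
        ENNReal.ofReal ((∑' k : d → ℤ, heatCoeff s k) - 1) := by
      rw [ENNReal.ofReal_sub _ zero_le_one, ENNReal.ofReal_one, hX, ENNReal.add_sub_cancel_left
        ENNReal.one_ne_top]
    -- factor out `1 − e^{-ρs}`
    have hGs : ∀ k, G k s = ENNReal.ofReal (1 - Real.exp (-ρ * s)) *
        (if k = 0 then (0 : ℝ≥0∞) else ENNReal.ofReal (heatCoeff s k)) := by
      intro k
      by_cases hk : k = 0
      · simp [hG_def, hk]
      · simp only [hG_def, if_neg hk, heatCoeff_apply]
        rw [mul_comm (Real.exp _), ENNReal.ofReal_mul h1s]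
        congr 2
        ring
    rw [tsum_congr hGs, ENNReal.tsum_mul_left, hΘ', ← ENNReal.ofReal_mul h1s]
  -- ### the pointwise bound of the integrand and the two pieces
  have hbound : ∀ s : ℝ, 0 < s →
      ENNReal.ofReal ((1 - Real.exp (-ρ * s)) * ((∑' k : d → ℤ, heatCoeff s k) - 1)) ≤
        ENNReal.ofReal ((1 - Real.exp (-ρ * s)) * (C₀ * s ^ (-(3 / 2 : ℝ)))) := by
    intro s hs
    have h1s : 0 ≤ 1 - Real.exp (-ρ * s) := by
      rw [sub_nonneg, Real.exp_le_one_iff]; nlinarith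
    refine ENNReal.ofReal_le_ofReal (mul_le_mul_of_nonneg_left ?_ h1s)
    have h := hΘ s hs
    norm_num at h ⊢
    exact h
  have hpiece1 : ∀ s ∈ Ioc (0 : ℝ) (1 / ρ),
      ENNReal.ofReal ((1 - Real.exp (-ρ * s)) * (C₀ * s ^ (-(3 / 2 : ℝ)))) ≤
        ENNReal.ofReal (C₀ * ρ * s ^ (-(1 / 2 : ℝ))) := by
    intro s hs
    refine ENNReal.ofReal_le_ofReal ?_
    have hle : 1 - Real.exp (-ρ * s) ≤ ρ * s := by
      -- `1 − e^{-x} ≤ x` (`Real.add_one_le_exp`)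
      have := Real.add_one_le_exp (-(ρ * s))
      rw [show -(ρ * s) = -ρ * s by ring] at this
      linarith
    have hs32 : 0 ≤ C₀ * s ^ (-(3 / 2 : ℝ)) := mul_nonneg hC₀ (Real.rpow_nonneg hs.1.le _)
    calc (1 - Real.exp (-ρ * s)) * (C₀ * s ^ (-(3 / 2 : ℝ)))
        ≤ (ρ * s) * (C₀ * s ^ (-(3 / 2 : ℝ))) := mul_le_mul_of_nonneg_right hle hs32
      _ = C₀ * ρ * (s ^ (1 : ℝ) * s ^ (-(3 / 2 : ℝ))) := by rw [Real.rpow_one]; ring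
      _ = C₀ * ρ * s ^ (-(1 / 2 : ℝ)) := by
          rw [← Real.rpow_add hs.1]
          norm_num
  have hpiece2 : ∀ s ∈ Ioi (1 / ρ),
      ENNReal.ofReal ((1 - Real.exp (-ρ * s)) * (C₀ * s ^ (-(3 / 2 : ℝ)))) ≤
        ENNReal.ofReal (C₀ * s ^ (-(3 / 2 : ℝ))) := by
    intro s hs
    have hs0 : 0 < s := (one_div_pos.2 hρ).trans hs
    refine ENNReal.ofReal_le_ofReal ?_
    have hs32 : 0 ≤ C₀ * s ^ (-(3 / 2 : ℝ)) := mul_nonneg hC₀ (Real.rpow_nonneg hs0.le _)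
    calc (1 - Real.exp (-ρ * s)) * (C₀ * s ^ (-(3 / 2 : ℝ)))
        ≤ 1 * (C₀ * s ^ (-(3 / 2 : ℝ))) :=
          mul_le_mul_of_nonneg_right (by linarith [Real.exp_pos (-ρ * s)]) hs32
      _ = C₀ * s ^ (-(3 / 2 : ℝ)) := one_mul _
  -- ### assembling the integral bound
  have hρinv : 0 < 1 / ρ := one_div_pos.2 hρ
  have hI : ∫⁻ s in Ioi (0 : ℝ), ∑' k, G k s ≤ ENNReal.ofReal (4 * C₀ * ρ ^ (1 / 2 : ℝ)) := by
    calc ∫⁻ s in Ioi (0 : ℝ), ∑' k, G k s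
        = ∫⁻ s in Ioi (0 : ℝ), ENNReal.ofReal ((1 - Real.exp (-ρ * s)) *
            ((∑' k : d → ℤ, heatCoeff s k) - 1)) :=
          setLIntegral_congr_fun measurableSet_Ioi fun s hs => hsum_s s hs
      _ ≤ ∫⁻ s in Ioi (0 : ℝ), ENNReal.ofReal ((1 - Real.exp (-ρ * s)) * (C₀ * s ^ (-(3 / 2 : ℝ)))) :=
          setLIntegral_mono' measurableSet_Ioi fun s hs => hbound s hs
      _ = ∫⁻ s in Ioc (0 : ℝ) (1 / ρ) ∪ Ioi (1 / ρ),
            ENNReal.ofReal ((1 - Real.exp (-ρ * s)) * (C₀ * s ^ (-(3 / 2 : ℝ)))) := by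
          rw [Ioc_union_Ioi_eq_Ioi hρinv.le]
      _ ≤ (∫⁻ s in Ioc (0 : ℝ) (1 / ρ), ENNReal.ofReal ((1 - Real.exp (-ρ * s)) * (C₀ * s ^ (-(3 / 2 : ℝ))))) +
            ∫⁻ s in Ioi (1 / ρ), ENNReal.ofReal ((1 - Real.exp (-ρ * s)) * (C₀ * s ^ (-(3 / 2 : ℝ)))) :=
          lintegral_union_le _ _ _
      _ ≤ (∫⁻ s in Ioc (0 : ℝ) (1 / ρ), ENNReal.ofReal (C₀ * ρ * s ^ (-(1 / 2 : ℝ)))) +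
            ∫⁻ s in Ioi (1 / ρ), ENNReal.ofReal (C₀ * s ^ (-(3 / 2 : ℝ))) :=
          add_le_add (setLIntegral_mono' measurableSet_Ioc hpiece1)
            (setLIntegral_mono' measurableSet_Ioi hpiece2)
      _ = ENNReal.ofReal (C₀ * ρ) * ENNReal.ofReal (2 * (1 / ρ) ^ (1 / 2 : ℝ)) +
            ENNReal.ofReal C₀ * ENNReal.ofReal (2 * (1 / ρ) ^ (-(1 / 2 : ℝ))) := by
          rw [← lintegral_Ioc_rpow_neg_half hρinv, ← lintegral_Ioi_rpow_neg_three_halves hρinv,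
            ← lintegral_const_mul' _ _ ENNReal.ofReal_ne_top,
            ← lintegral_const_mul' _ _ ENNReal.ofReal_ne_top]
          congr 1
          · refine lintegral_congr fun s => ?_
            rw [← ENNReal.ofReal_mul (by positivity)]
          · refine lintegral_congr fun s => ?_
            rw [← ENNReal.ofReal_mul hC₀]
      _ = ENNReal.ofReal (4 * C₀ * ρ ^ (1 / 2 : ℝ)) := by
          rw [← ENNReal.ofReal_mul (by positivity), ← ENNReal.ofReal_mul hC₀,
            ← ENNReal.ofReal_add (by positivity) (by positivity)]
          congr 1
          have e1 : (1 / ρ) ^ (1 / 2 : ℝ) = ρ ^ (-(1 / 2 : ℝ)) := by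
            rw [one_div, Real.inv_rpow hρ.le, Real.rpow_neg hρ.le]
          have e2 : (1 / ρ) ^ (-(1 / 2 : ℝ)) = ρ ^ (1 / 2 : ℝ) := by
            rw [one_div, Real.inv_rpow hρ.le, Real.rpow_neg hρ.le, inv_inv]
          have e3 : ρ * ρ ^ (-(1 / 2 : ℝ)) = ρ ^ (1 / 2 : ℝ) := by
            rw [← Real.rpow_one_add' hρ.le (by norm_num : (1 : ℝ) + -(1 / 2 : ℝ) ≠ 0)]
            norm_num
          rw [e1, e2]
          calc C₀ * ρ * (2 * ρ ^ (-(1 / 2 : ℝ))) + C₀ * (2 * ρ ^ (1 / 2 : ℝ))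
              = 2 * C₀ * (ρ * ρ ^ (-(1 / 2 : ℝ))) + 2 * C₀ * ρ ^ (1 / 2 : ℝ) := by ring
            _ = 4 * C₀ * ρ ^ (1 / 2 : ℝ) := by rw [e3]; ring
  -- ### back to the real sum
  have hfin : ENNReal.ofReal (∑' k, a k) ≤ ENNReal.ofReal (4 * C₀ * ρ ^ (1 / 2 : ℝ)) := by
    rw [ENNReal.ofReal_tsum_of_nonneg ha0 has, tsum_congr hGk, hT]
    exact hI
  exact (ENNReal.ofReal_le_ofReal_iff (by positivity)).1 hfin

end Torus

end Literature.Analysis.FunctionSpaces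

end
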